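import Literature.Analysis.FunctionSpaces.TorusDerivBounds
import Literature.Analysis.FunctionSpaces.TorusFourierModes
import HarnessLib

/-!
# All-order derivative bounds for real trigonometric polynomials on `T^d`

Analysis/FunctionSpaces support file (everything proved; no named facts). The building blocks
of convex-integration schemes started from an explicit shear flow — the starting tuples of
Colombo–De Lellis–De Rosa 2018, Lemma 3.1 (`CDLDR.shearVelocity`, `FractionalNSStartingTriple`)
and of De Lellis–Kwon 2022, §2.3 (`GloballyDissipativeEulerStart`) — are single real Fourier
modes `Re (e_k(x) • z)`, and the inductive estimates of those schemes ask for sup bounds on ALL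
spatial derivatives up to order `2` ("`‖v₀‖_N ≤ (1-2δ₀^{1/2})^{1/2} λ̄^N`", DLK §2.3). This file
records the elementary bookkeeping: each partial derivative of `realTrigPoly S c` multiplies the
coefficient `c k` by `2πi kⱼ` (`Torus.partialDeriv_realTrigPoly`), hence

* `Torus.iterPartialDeriv_realTrigPoly` — `∂^l realTrigPoly S c = realTrigPoly S (k ↦ (∏_{j ∈ l} 2πi kⱼ) • c k)`;
* `Torus.norm_iterPartialDeriv_realTrigPoly_singleton_le` — for a single mode,
  `‖∂^l Re (e_k • z) (x)‖ ≤ (2π|k|)^{|l|} ‖z‖`;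
* `Torus.hasDerivBounds_realTrigPoly_singleton` — the same in the currency `Torus.HasDerivBounds`
  of `TorusDerivBounds` (`C = ‖z‖`, `L = 2π|k|`).

## References

* C. De Lellis, H. Kwon, Anal. PDE 15 (2022) = arXiv:2006.06482, §2.3 (estimates of the
  starting tuple). [DelellisKwon2022]
* L. Grafakos, *Classical Fourier Analysis*, 3rd ed. (2014), §3.1 (derivatives of characters).
-/

noncomputable section

open Set Function UnitAddTorus

namespace Literature.Analysis.FunctionSpaces

namespace Torus

variable {d : Type*} [Fintype d] [DecidableEq d]

/-- The coefficient multiplier of an iterated partial derivative of a trigonometric polynomial: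
`∏_{j ∈ l} (2πi kⱼ)`. [folklore] -/
def derivMultiplier (l : List d) (k : d → ℤ) : ℂ :=
  (l.map fun j => (2 * Real.pi * Complex.I * (k j : ℂ))).prod

omit [Fintype d] [DecidableEq d] in
/-- `derivMultiplier [] k = 1`. [folklore] -/
@[simp] theorem derivMultiplier_nil (k : d → ℤ) : derivMultiplier ([] : List d) k = 1 := by
  simp [derivMultiplier]

omit [Fintype d] [DecidableEq d] in
/-- `derivMultiplier (j :: l) k = (2πi kⱼ) derivMultiplier l k`. [folklore] -/
@[simp] theorem derivMultiplier_cons (j : d) (l : List d) (k : d → ℤ) :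
    derivMultiplier (j :: l) k = (2 * Real.pi * Complex.I * (k j : ℂ)) * derivMultiplier l k := by
  simp [derivMultiplier]

omit [Fintype d] [DecidableEq d] in
/-- `‖derivMultiplier l k‖ ≤ (2π √(freqNormSq k))^{|l|}` (`|kⱼ| ≤ |k|`). [folklore] -/
theorem norm_derivMultiplier_le [Fintype d] (l : List d) (k : d → ℤ) :
    ‖derivMultiplier l k‖ ≤ (2 * Real.pi * Real.sqrt (freqNormSq k)) ^ l.length := by
  induction l with
  | nil => simp
  | cons j l ih =>
    rw [derivMultiplier_cons, norm_mul, List.length_cons, pow_succ, mul_comm (_ ^ _)]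
    refine mul_le_mul ?_ ih (norm_nonneg _) (by positivity)
    have h1 : ‖(2 * Real.pi * Complex.I * (k j : ℂ) : ℂ)‖ = 2 * Real.pi * |(k j : ℝ)| := by
      rw [norm_mul, norm_mul, norm_mul, Complex.norm_I, mul_one, Complex.norm_ofNat, Complex.norm_real,
        Real.norm_eq_abs, abs_of_pos Real.pi_pos, ← Complex.ofReal_intCast, Complex.norm_real,
        Real.norm_eq_abs]
    rw [h1]
    gcongr
    exact abs_apply_le_sqrt_freqNormSq k j

/-- **Iterated partial derivatives of a real trigonometric polynomial**:
`∂^l realTrigPoly S c = realTrigPoly S (k ↦ derivMultiplier l k • c k)`. [folklore] -/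
theorem iterPartialDeriv_realTrigPoly (S : Finset (d → ℤ)) (c : (d → ℤ) → EuclideanSpace ℂ d) :
    ∀ l : List d, iterPartialDeriv l (realTrigPoly S c) =
      realTrigPoly S (fun k => derivMultiplier l k • c k)
  | [] => by simp
  | j :: l => by
    rw [iterPartialDeriv_cons, iterPartialDeriv_realTrigPoly S c l, partialDeriv_realTrigPoly']
    congr 1
    funext k
    rw [derivMultiplier_cons, smul_smul]

/-- **All-order sup bounds for a single real mode**:
`‖∂^l Re (e_k • z) (x)‖ ≤ (2π|k|)^{|l|} ‖z‖`. [folklore] -/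
theorem norm_iterPartialDeriv_realTrigPoly_singleton_le (k : d → ℤ) (c : (d → ℤ) → EuclideanSpace ℂ d)
    (l : List d) (x : UnitAddTorus d) :
    ‖iterPartialDeriv l (realTrigPoly {k} c) x‖ ≤
      (2 * Real.pi * Real.sqrt (freqNormSq k)) ^ l.length * ‖c k‖ := by
  rw [iterPartialDeriv_realTrigPoly]
  refine (norm_realTrigPoly_singleton_le k _ x).trans ?_
  rw [norm_smul]
  exact mul_le_mul_of_nonneg_right (norm_derivMultiplier_le l k) (norm_nonneg _)

/-- A single real mode in the `HasDerivBounds` currency: `C = ‖z‖`, `L = 2π|k|`, every order. [folklore] -/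
theorem hasDerivBounds_realTrigPoly_singleton (n : ℕ) (k : d → ℤ) (c : (d → ℤ) → EuclideanSpace ℂ d) :
    HasDerivBounds n (realTrigPoly {k} c) ‖c k‖ (2 * Real.pi * Real.sqrt (freqNormSq k)) :=
  ⟨isSmooth_realTrigPoly _ _, fun l _ x => by
    rw [mul_comm]
    exact norm_iterPartialDeriv_realTrigPoly_singleton_le k c l x⟩

end Torus

end Literature.Analysis.FunctionSpaces
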